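import Mathlib
import HarnessLib

/-!
# Crux 4 `BSDpOnCellC` (stmt-BirchSwinnertonDyer-19034), line b1, stub `stub_ctlOrSwitch` — kernel brick
# toward CTL-split WITH TORSION (cell `bsd-eis`, seat `bsd-eis-cgshw` g11; memo `cgshw-MEMO-14.md` §2 L2,
# §5 K3): NO NEW `p`-POWER ROOTS OF GROUND-FIELD ELEMENTS IN A NORMAL EXTENSION WITHOUT `p`-TH ROOTS
# OF UNITY.

HONEST FRAMING (cell `bsd-eis`, run/shared/lean/pub/bsd-eis/): theorems only (pure field theory over
Mathlib); nothing booked; X2 stays CONSTRUCTION-SHAPED; no label or count moves. Helper for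
stmt-BirchSwinnertonDyer-19034 (`--supports`), not a closer.

WHAT IS HERE. For a NORMAL field extension `L/F`, a prime `p` with `(p : L) ≠ 0`, and NO non-trivial
`p`-th root of unity in `L`:
* `mem_range_algebraMap_of_pow_prime_eq` — if `y ∈ L` and `y ^ p ∈ F` then `y ∈ F`;
* `mem_range_algebraMap_of_pow_prime_pow_eq` — the same with `y ^ (p ^ k) ∈ F`;
* `exists_pow_eq_of_exists_pow_eq_algebraMap` — an element of `F` that is a `p ^ k`-th power in `L`
  is already a `p ^ k`-th power in `F`.
Proof: if `b := y ^ p` is not a `p`-th power in `F`, `X ^ p - C b` is irreducible (Kummer's criterion,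
Mathlib `X_pow_sub_C_irreducible_iff_of_prime`), hence the minimal polynomial of `y`; by normality it
splits in `L`; it is separable, so it has `p ≥ 2` distinct roots in `L`, and the quotient of two of them
is a non-trivial `p`-th root of unity — contradiction.

WHY (MEMO-14 L2 / K3). At a split multiplicative `p ‖ N`, `E ≅ ℚ_p^×/q^ℤ` over `ℚ_p` (Tate), and for
every layer `L = K_{n,𝔴}` of the local anticyclotomic tower — a Galois (cyclic, `p`-power degree)
extension of `ℚ_p`, which for `p` odd contains no primitive `p`-th root of unity — the `p`-power
torsion `E(L)[p^k] ≅ {m mod p^k : q^m ∈ L^{×p^k}}` does not grow: by the third theorem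
`q^m ∈ L^{×p^k} ⇒ q^m ∈ ℚ_p^{×p^k}`, so `E(K_{∞,𝔴})[p^∞] = E(ℚ_p)[p^∞]` with TRIVIAL action of the
decomposition group — the input of the local-kernel count `#ker g_𝔭 = #E(ℚ_p)[p^∞]` (K3) and of the
finiteness (I1-loc) of k5-c4 MEMO-2. This file is the field-theoretic half; the Tate-curve half is not
here.

References: Lang, *Algebra*, VI §9 (Kummer theory); cgshw MEMO-14 §2 L2.
-/

open Polynomial

set_option linter.dupNamespace false

namespace Summit.BirchSwinnertonDyer.BirchSwinnertonDyer.Theorems.NoNewPPowerRoots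

variable {F L : Type*} [Field F] [Field L] [Algebra F L]

/-- **No new `p`-th roots in a normal extension without `p`-th roots of unity.** Let `L/F` be a
normal extension of fields, `p` a prime with `(p : L) ≠ 0`, and assume `L` contains no `p`-th root of
unity other than `1`. If `y ∈ L` satisfies `y ^ p = b` for some `b ∈ F`, then `y ∈ F`. (If `b` is a
`p`-th power `c ^ p` in `F`, then `y / c` is a `p`-th root of unity, so `y = c`; otherwise
`X ^ p - C b` is irreducible over `F` by Kummer's criterion, equals the minimal polynomial of `y`,
splits in the normal `L` with `p ≥ 2` distinct roots, and the ratio of two distinct roots is a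
non-trivial `p`-th root of unity.) [folklore] -/
theorem mem_range_algebraMap_of_pow_prime_eq [Normal F L] {p : ℕ} (hp : p.Prime)
    (hpL : (p : L) ≠ 0) (hζ : ∀ ζ : L, ζ ^ p = 1 → ζ = 1) {y : L} {b : F}
    (hy : y ^ p = algebraMap F L b) : y ∈ (algebraMap F L).range := by
  classical
  by_cases hb : ∃ c : F, c ^ p = b
  · obtain ⟨c, rfl⟩ := hb
    by_cases hc : c = 0
    · subst hc
      have hy0 : y ^ p = 0 := by rw [hy, zero_pow hp.ne_zero, map_zero]
      exact ⟨0, by rw [map_zero, (pow_eq_zero_iff hp.ne_zero).mp hy0]⟩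
    · have hc' : algebraMap F L c ≠ 0 := by
        rwa [Ne, map_eq_zero_iff _ (algebraMap F L).injective]
      have h1 : (y / algebraMap F L c) ^ p = 1 := by
        rw [div_pow, hy, map_pow, div_self (pow_ne_zero _ hc')]
      have h2 : y / algebraMap F L c = 1 := hζ _ h1
      exact ⟨c, ((div_eq_one_iff_eq hc').mp h2).symm⟩
  · push Not at hb
    have hirr : Irreducible (X ^ p - C b) := (X_pow_sub_C_irreducible_iff_of_prime hp).mpr hb
    have hb0 : b ≠ 0 := fun h => hb 0 (by rw [h, zero_pow hp.ne_zero])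
    have hb0' : algebraMap F L b ≠ 0 := by
      rwa [Ne, map_eq_zero_iff _ (algebraMap F L).injective]
    have hmonic : (X ^ p - C b).Monic := monic_X_pow_sub_C b hp.ne_zero
    have haeval : aeval y (X ^ p - C b) = 0 := by
      simp only [map_sub, map_pow, aeval_X, aeval_C, hy, sub_self]
    have hmin : X ^ p - C b = minpoly F y := minpoly.eq_of_irreducible_of_monic hirr haeval hmonic
    have hspl : Splits ((X ^ p - C b).map (algebraMap F L)) := by
      rw [hmin]
      exact Normal.splits ‹Normal F L› y
    have hmap : (X ^ p - C b).map (algebraMap F L) = X ^ p - C (algebraMap F L b) := by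
      simp only [Polynomial.map_sub, Polynomial.map_pow, map_X, map_C]
    rw [hmap] at hspl
    set g : L[X] := X ^ p - C (algebraMap F L b) with hg
    have hg0 : g ≠ 0 := X_pow_sub_C_ne_zero hp.pos _
    have hsep : g.Separable := separable_X_pow_sub_C _ hpL hb0'
    have hnodup : g.roots.Nodup := nodup_roots hsep
    have hcard : g.roots.card = p := by
      rw [← hspl.natDegree_eq_card_roots, hg, natDegree_X_pow_sub_C]
    have hroot : ∀ r : L, r ∈ g.roots ↔ r ^ p = algebraMap F L b := by
      intro r
      rw [mem_roots hg0, IsRoot.def, hg, eval_sub, eval_pow, eval_X, eval_C, sub_eq_zero]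
    have hy_root : y ∈ g.roots := (hroot y).mpr hy
    -- a second, different root
    obtain ⟨r, hr, hry⟩ : ∃ r ∈ g.roots, r ≠ y := by
      by_contra h
      push Not at h
      have hcount : g.roots.count y = g.roots.card := by
        rw [Multiset.count_eq_card]
        intro x hx
        exact (h x hx).symm
      have hle : g.roots.count y ≤ 1 := Multiset.nodup_iff_count_le_one.mp hnodup y
      rw [hcount, hcard] at hle
      exact absurd hle (not_le.mpr hp.two_le)
    have hy0 : y ≠ 0 := by
      rintro rfl
      rw [zero_pow hp.ne_zero] at hy
      exact hb0' hy.symm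
    have hr' : r ^ p = algebraMap F L b := (hroot r).mp hr
    have h1 : (r / y) ^ p = 1 := by
      rw [div_pow, hr', ← hy, div_self (pow_ne_zero _ hy0)]
    have h2 : r / y = 1 := hζ _ h1
    exact absurd ((div_eq_one_iff_eq hy0).mp h2) hry

/-- **No new `p ^ k`-th roots** (induction on `k` from `mem_range_algebraMap_of_pow_prime_eq`): under
the same hypotheses (`L/F` normal, `(p : L) ≠ 0`, no non-trivial `p`-th root of unity in `L`), if
`y ∈ L` and `y ^ (p ^ k) ∈ F` then `y ∈ F`. [folklore] -/
theorem mem_range_algebraMap_of_pow_prime_pow_eq [Normal F L] {p : ℕ} (hp : p.Prime)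
    (hpL : (p : L) ≠ 0) (hζ : ∀ ζ : L, ζ ^ p = 1 → ζ = 1) (k : ℕ) {y : L} {b : F}
    (hy : y ^ (p ^ k) = algebraMap F L b) : y ∈ (algebraMap F L).range := by
  induction k generalizing y b with
  | zero =>
    rw [pow_zero, pow_one] at hy
    exact ⟨b, hy.symm⟩
  | succ k ih =>
    rw [pow_succ, pow_mul] at hy
    obtain ⟨b', hb'⟩ := mem_range_algebraMap_of_pow_prime_eq hp hpL hζ hy
    exact ih hb'.symm

/-- **An element of the ground field that becomes a `p ^ k`-th power upstairs was already a
`p ^ k`-th power downstairs**: for `L/F` normal, `(p : L) ≠ 0`, no non-trivial `p`-th root of unity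
in `L`, and `x ∈ F` with `x = y ^ (p ^ k)` for some `y ∈ L`, there is `y₀ ∈ F` with
`y₀ ^ (p ^ k) = x`. Applied with `F = ℚ_p`, `L` a layer of the local anticyclotomic `ℤ_p`-tower at a
split `p` (`p` odd, so `μ_p ⊄ L`) and `x = q_E ^ m` (Tate parameter): the `p`-power torsion of the Tate
curve does not grow in the tower (cgshw MEMO-14 §2 L2). [folklore] -/
theorem exists_pow_eq_of_exists_pow_eq_algebraMap [Normal F L] {p : ℕ} (hp : p.Prime)
    (hpL : (p : L) ≠ 0) (hζ : ∀ ζ : L, ζ ^ p = 1 → ζ = 1) (k : ℕ) {x : F}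
    (hx : ∃ y : L, y ^ (p ^ k) = algebraMap F L x) : ∃ y₀ : F, y₀ ^ (p ^ k) = x := by
  obtain ⟨y, hy⟩ := hx
  obtain ⟨y₀, rfl⟩ := mem_range_algebraMap_of_pow_prime_pow_eq hp hpL hζ k hy
  refine ⟨y₀, (algebraMap F L).injective ?_⟩
  rw [map_pow, hy]


/-! ### §2 (append, cgshw g11) — the hypothesis «no `p`-th roots of unity» in a `p`-power-degree
extension: it descends from the ground field -/

/-- **No non-trivial `p`-th root of unity in an extension of `p`-power degree of a field that has
none.** Let `L/F` be a finite extension of fields with `[L : F] = p ^ n` (`p` prime) and assume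
`F` contains no `p`-th root of unity other than `1`. Then neither does `L`: a `ζ ∈ L` with `ζ ^ p = 1`,
`ζ ≠ 1` is a primitive `p`-th root of unity, hence a root of the `p`-th cyclotomic polynomial, so
`[F(ζ) : F] ≤ p - 1 < p`; but `[F(ζ) : F]` divides `[L : F] = p ^ n`, so it is `1`, i.e. `ζ ∈ F`,
contradiction. USE (cgshw MEMO-14 §2 L2 / K3): `F = ℚ_p` with `p` odd (`μ_p(ℚ_p) = 1`, tree
`X11b.CongruentTransfer.padic_pow_eq_one_imp_eq_one`) and `L` a layer of the local anticyclotomic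
`ℤ_p`-tower (cyclic of `p`-power degree over `ℚ_p`) — this supplies the hypothesis `hζ` of
`mem_range_algebraMap_of_pow_prime_eq` / `exists_pow_eq_of_exists_pow_eq_algebraMap`. [folklore] -/
theorem pow_prime_eq_one_imp_eq_one_of_finrank_eq_prime_pow [FiniteDimensional F L] {p : ℕ}
    (hp : p.Prime) (hF : ∀ c : F, c ^ p = 1 → c = 1) {n : ℕ} (hL : Module.finrank F L = p ^ n) :
    ∀ ζ : L, ζ ^ p = 1 → ζ = 1 := by
  intro ζ hζ
  by_contra hne
  haveI : Fact p.Prime := ⟨hp⟩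
  have hint : IsIntegral F ζ := .of_finite F ζ
  -- `ζ` is a primitive `p`-th root of unity, hence a root of `cyclotomic p`
  have hord : orderOf ζ = p := orderOf_eq_prime hζ hne
  have hprim : IsPrimitiveRoot ζ p := hord ▸ IsPrimitiveRoot.orderOf ζ
  have hroot : aeval ζ (cyclotomic p F) = 0 := by
    rw [aeval_def, eval₂_eq_eval_map, map_cyclotomic]
    exact (hprim.isRoot_cyclotomic hp.pos).eq_zero
  -- so the degree `d` of `ζ` over `F` is at most `p - 1`
  have hdle : (minpoly F ζ).natDegree ≤ p - 1 := by
    have h := natDegree_le_of_dvd (minpoly.dvd F ζ hroot) (cyclotomic_ne_zero p F)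
    rwa [natDegree_cyclotomic, Nat.totient_prime hp] at h
  -- and divides `[L : F] = p ^ n`, so it is a power of `p`, hence `1`
  have hdvd : (minpoly F ζ).natDegree ∣ p ^ n := hL ▸ minpoly.degree_dvd hint
  obtain ⟨i, hi, hdi⟩ := (Nat.dvd_prime_pow hp).mp hdvd
  have hi0 : i = 0 := by
    by_contra hi0
    have hle : p ≤ p ^ i := Nat.le_self_pow hi0 p
    have := hp.two_le
    omega
  rw [hi0, pow_zero] at hdi
  -- degree one: `ζ ∈ F`
  have hdeg : (minpoly F ζ).degree = 1 := by
    rw [degree_eq_natDegree (minpoly.ne_zero hint), hdi, Nat.cast_one]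
  obtain ⟨c, hc⟩ := minpoly.mem_range_of_degree_eq_one F ζ hdeg
  have hcp : c ^ p = 1 := (algebraMap F L).injective (by rw [map_pow, hc, hζ, map_one])
  exact hne (by rw [← hc, hF c hcp, map_one])

end Summit.BirchSwinnertonDyer.BirchSwinnertonDyer.Theorems.NoNewPPowerRoots
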